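import Literature.Analysis.FluidPDE.AncientMildRepresentative
import Literature.Analysis.FluidPDE.KNSSSwirlLiouville
import HarnessLib

/-!
# `knss_bound_C_over_r` reduced to the named facts of the printed proof of KNSS 2009, Thm 5.3

Analysis/FluidPDE glue file (all results proved) for the named fact
`Literature.Analysis.FluidPDE.knss_bound_C_over_r` (`SelfSimilarLiouville`; Koch–Nadirashvili–
Seregin–Šverák, Acta Math. 203 (2009) = arXiv:0709.3599, Theorem 5.3, rendered in the tree's
duality-form class of bounded ancient mild solutions). Two chains in the tree meet here:

* the **bridge** `Literature.Analysis.FluidPDE.knss_bound_C_over_r_of_KNSS2009`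
  (`AncientMildRepresentative`): Theorem 5.3 as printed, for bounded weak solutions
  (`Literature.Analysis.FluidPDE.KNSS2009_liouville_bound_C_over_r`, `KNSSLiouville`), implies the
  duality-form fact (mild ⇒ weak in `L^∞`, weak-* continuity in time, jointly measurable
  modification, a.e.-time ⇒ every slice);
* the **reduction of the printed theorem to the inputs of its printed proof**
  `Literature.Analysis.FluidPDE.KNSS2009_liouville_bound_C_over_r_of_facts` (`KNSSSwirlLiouville`):
  the §4 regularity package with the swirl equation (5.10)
  (`KNSS2009_regularity_axisymmetric_swirl`), the cut-off/rescaling argument (5.12)–(5.20)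
  (`KNSS2009_swirl_sup_nonpos`), and Theorem 5.2 (`KNSS2009_liouville_axisymmetric_no_swirl`).

Composing them, `knss_bound_C_over_r` follows from exactly these three named facts
(`knss_bound_C_over_r_of_facts`); discharging them discharges the tree's fact.

## References

* G. Koch, N. Nadirashvili, G. Seregin, V. Šverák, *Liouville theorems for the Navier–Stokes
  equations and applications*, Acta Math. 203 (2009) 83–105 = arXiv:0709.3599, Theorem 5.3 and
  its proof (p. 10), §4 (p. 8), Theorem 5.2 (pp. 9–10). [KochNadirashviliSereginSverak2009]
-/

noncomputable section

namespace Literature.Analysis.FluidPDE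

/-- **`knss_bound_C_over_r` from the three named inputs of the printed proof of Theorem 5.3**
(KNSS 2009, arXiv p. 10): the §4 regularity package with the swirl equation for an axisymmetric
bounded weak solution, the cut-off/rescaling argument `sup f ≤ 0` for `f = r u_θ`, and
Theorem 5.2; via the printed theorem (`KNSS2009_liouville_bound_C_over_r_of_facts`) and the
bridge to the duality-form class (`knss_bound_C_over_r_of_KNSS2009`). [cite: KochNadirashviliSereginSverak2009, Thm 5.3 and its proof (arXiv p. 10)] -/
theorem knss_bound_C_over_r_of_facts (hreg : KNSS2009_regularity_axisymmetric_swirl)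
    (hsup : KNSS2009_swirl_sup_nonpos) (h52 : KNSS2009_liouville_axisymmetric_no_swirl) :
    knss_bound_C_over_r :=
  knss_bound_C_over_r_of_KNSS2009 (KNSS2009_liouville_bound_C_over_r_of_facts hreg hsup h52)

end Literature.Analysis.FluidPDE
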